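/-
Copyright (c) 2026. All rights reserved.
Released under Apache 2.0 license as described in the file LICENSE.
Authors: abc-iut cell, prover seat abc-iut-L4-t5 (gen 10; row «F3757-PORT», abc-iut-L4-lead m147 (5)), over abc-iut-L4-t15's
`DiagramTelecorePaths.lean` (`lastSplit`) and abc-iut-f-101's `DiagramPathEmbeddings.lean` (`GraphEmbedding`).
-/
import Literature.AnabelianGeometry.AbsoluteAnabelian.LogFrobeniusAnTelecoreOverE
import HarnessLib

/-!
# [AbsTopIII] Cor 5.5 (ii)/(iii): paths of the telecore diagram `D_{An•}` into an observation vertex — the last visit of `An•[𝒳]`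

S. Mochizuki, *Topics in absolute anabelian geometry III: global reconstruction algorithms*,
J. Math. Sci. Univ. Tokyo 22 (2015) 939–1156 [MochizukiAbsTopIII2015]; manuscript `paper:url-5493eb38cbb7`, locators read on the
page: §0 p. 26 (oriented graphs, paths), Def 3.5 (iv) p. 76 (telecore edges run from the core vertex back into the diagram:
the boundary pairs `([γ₃]∘[γ₁], [γ₃]∘[γ₂])`), Cor 5.5 (ii) p. 130 (the telecore edges `φ_⋏ : An•[𝒳] → 𝒳_⋏`, `⋏ ∈ L ∪ {□}`, RETURN to
the first two rows of `D•`), (iii) p. 131 (the observables `S_log⊞_v`, `S_log_v` on `D•_{≤2} ∪ {𝒩⊞_v}`, `(D•_{≤3})_v ∪ {𝒩_v}` — inside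
`D_{An•}`).

WHY (row «F3757-PORT», file 2 of the mover).  In the MONO-analytic telecore `D_{An⊢}` (Cor 5.10 (iv), abc-iut-f-101's D2) no arrow
enters the observables' sub-diagrams from outside (a SIEVE, `IsSieve`): every path into `𝒩⊞_v` lifts.  In `D_{An•}` the telecore
edges `φ_⋏` land in the first two rows, so a path into `𝒩⊞_v` / `𝒩_v` / `ℰ•` may LOOP through the core vertex `An•[𝒳]`
(`… → ℰ• → An•[𝒳] →(φ_⋏) 𝒳_⋏ → … → □ →(λ⊞) 𝒩⊞_v`).  This file is the path combinatorics of that situation, for the common shape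
`embObs` of the three sub-observable inclusions (file 1) and a predecessor-closed sub-diagram `D_{≤P} ∪ {x}`:

* `lastSplit_embObs_mapPath` — an included path never visits `An•[𝒳]`; `lastSplit_outerPath` — a path `a ; φ_⋏ ; (included u)` visits it
  last at the telecore edge;
* `exists_inner_or_outer` — **every path of `D_{An•}` into a vertex of the sub-diagram is EITHER an included path (INNER) OR
  `a ; φ_⋏ ; (included u)` with `a` an arbitrary path into `An•[𝒳]` (OUTER)** — the relative form of abc-iut-f-101's
  `IsSieve.exists_mapPath`;
* `outerTail_injective`, `inner_ne_outer` — uniqueness of these presentations (with abc-iut-f-101's `GraphEmbedding.eq_of_mapPath_heq`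
  for the inner one).

Pure combinatorics; nothing here bears on [IUTchIII] Cor. 3.12; no side taken.
-/

set_option autoImplicit false

universe u

open CategoryTheory Quiver

namespace Literature.AnabelianGeometry.AbsoluteAnabelian

namespace LogFrobeniusSetting

open DiagramOfCategories

variable {Vmod : Type u} {isArc : Vmod → Bool}

section Paths

variable (P : DVertex Vmod isArc → Prop) (xs : DVertex Vmod isArc) (hP : ∀ ⦃a : DVertex Vmod isArc⦄, P a → InFive (isArc := isArc) a)
  (hxs : InFive (isArc := isArc) xs)

/-- An included path never visits the core vertex `An•[𝒳]` (all its vertices are base vertices of `Γ⃗_{D_{An•}}`).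
[cite: MochizukiAbsTopIII2015, Definition 3.5 (iv) p.76] -/
theorem lastSplit_embObs_mapPath {a : (obsShape P xs).Vertex} :
    ∀ {b : (obsShape P xs).Vertex} (p : Path a b),
      (anShape (Vmod := Vmod) (isArc := isArc)).lastSplit ((embObs P xs hP hxs).mapPath p) = none
  | _, Path.nil => by cases a <;> rfl
  | b, Path.cons p e => by
    rw [Prefunctor.mapPath_cons]
    have ih := lastSplit_embObs_mapPath p
    revert e
    cases b <;> intro e <;>
    · change ((anShape (Vmod := Vmod) (isArc := isArc)).lastSplit ((embObs P xs hP hxs).mapPath p)).map _ = none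
      rw [ih]
      rfl

/-- The tail `φ_⋏ ; (included u)` of an outer path leaves `An•[𝒳]` at once and never returns.
[cite: MochizukiAbsTopIII2015, Definition 3.5 (iv) p.76] -/
theorem lastSplit_outerTail {c : DVertex Vmod isArc} {hc : P c}
    (j : (anShape (Vmod := Vmod) (isArc := isArc)).obs ⟶ (anShape (Vmod := Vmod) (isArc := isArc)).base ⟨c, hP hc⟩) :
    ∀ {b : (obsShape P xs).Vertex} (u : Path ((obsShape P xs).base ⟨c, hc⟩) b),
      (anShape (Vmod := Vmod) (isArc := isArc)).lastSplit ((Path.nil.cons j).comp ((embObs P xs hP hxs).mapPath u)) =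
        some (Path.nil, (Path.nil.cons j).comp ((embObs P xs hP hxs).mapPath u))
  | _, Path.nil => rfl
  | b, Path.cons u e => by
    have ih := lastSplit_outerTail j u
    revert e
    cases b <;> intro e <;>
    · change ((anShape (Vmod := Vmod) (isArc := isArc)).lastSplit ((Path.nil.cons j).comp ((embObs P xs hP hxs).mapPath u))).map _ =
        some _
      rw [ih]
      rfl

/-- The outer path `a ; φ_⋏ ; (included u)` re-associated: `a ; (φ_⋏ ; included u)`. [cite: MochizukiAbsTopIII2015, Section 0 p.26] -/
theorem outerPath_eq_comp {x : (anShape (Vmod := Vmod) (isArc := isArc)).Vertex} (a : Path x (anShape (Vmod := Vmod) (isArc := isArc)).obs)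
    {c : DVertex Vmod isArc} {hc : P c} (j : (anShape (Vmod := Vmod) (isArc := isArc)).obs ⟶ (anShape (Vmod := Vmod) (isArc := isArc)).base ⟨c, hP hc⟩)
    {b : (obsShape P xs).Vertex} (u : Path ((obsShape P xs).base ⟨c, hc⟩) b) :
    (a.cons j).comp ((embObs P xs hP hxs).mapPath u) = a.comp ((Path.nil.cons j).comp ((embObs P xs hP hxs).mapPath u)) := by
  rw [← Path.comp_assoc]
  rfl

/-- An outer path visits `An•[𝒳]` last at its telecore edge: last split `(a, φ_⋏ ; included u)`.
[cite: MochizukiAbsTopIII2015, Definition 3.5 (iv) p.76] -/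
theorem lastSplit_outerPath {x : (anShape (Vmod := Vmod) (isArc := isArc)).Vertex} (a : Path x (anShape (Vmod := Vmod) (isArc := isArc)).obs)
    {c : DVertex Vmod isArc} {hc : P c} (j : (anShape (Vmod := Vmod) (isArc := isArc)).obs ⟶ (anShape (Vmod := Vmod) (isArc := isArc)).base ⟨c, hP hc⟩)
    {b : (obsShape P xs).Vertex} (u : Path ((obsShape P xs).base ⟨c, hc⟩) b) :
    (anShape (Vmod := Vmod) (isArc := isArc)).lastSplit ((a.cons j).comp ((embObs P xs hP hxs).mapPath u)) =
      some (a, (Path.nil.cons j).comp ((embObs P xs hP hxs).mapPath u)) := by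
  rw [outerPath_eq_comp, ExtShape.lastSplit_comp, lastSplit_outerTail]
  rfl

variable (hnot : ¬ P xs)

include hnot in
/-- **The outer tail determines its data**: the telecore edge `φ_⋏` and the included path `u` are recovered from `φ_⋏ ; included u`.
[cite: MochizukiAbsTopIII2015, Section 0 p.26] -/
theorem outerTail_injective {c : DVertex Vmod isArc} {hc : P c}
    (j : (anShape (Vmod := Vmod) (isArc := isArc)).obs ⟶ (anShape (Vmod := Vmod) (isArc := isArc)).base ⟨c, hP hc⟩) :
    ∀ {b : (obsShape P xs).Vertex} (u : Path ((obsShape P xs).base ⟨c, hc⟩) b) {c' : DVertex Vmod isArc} {hc' : P c'}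
      (j' : (anShape (Vmod := Vmod) (isArc := isArc)).obs ⟶ (anShape (Vmod := Vmod) (isArc := isArc)).base ⟨c', hP hc'⟩)
      (u' : Path ((obsShape P xs).base ⟨c', hc'⟩) b),
      (Path.nil.cons j).comp ((embObs P xs hP hxs).mapPath u) = (Path.nil.cons j').comp ((embObs P xs hP hxs).mapPath u') →
        c = c' ∧ HEq j j' ∧ HEq u u'
  | _, Path.nil, c', hc', j', u', h => by
    cases u' with
    | nil =>
      obtain ⟨-, -, hj⟩ := Path.cons.inj h
      exact ⟨rfl, hj, HEq.rfl⟩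
    | cons u' e' =>
      rename_i d
      have h' : Path.cons Path.nil j =
          Path.cons ((Path.nil.cons j').comp ((embObs P xs hP hxs).mapPath u')) ((embObs P xs hP hxs).map e') := h
      obtain ⟨hd, -, -⟩ := Path.cons.inj h'
      exact absurd hd.symm (embObs_obj_ne_obs P xs hP hxs d)
  | b, Path.cons (b := d) u e, c', hc', j', u', h => by
    cases u' with
    | nil =>
      have h' : Path.cons ((Path.nil.cons j).comp ((embObs P xs hP hxs).mapPath u)) ((embObs P xs hP hxs).map e) =
          Path.cons Path.nil j' := h
      obtain ⟨hd, -, -⟩ := Path.cons.inj h'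
      exact absurd hd (embObs_obj_ne_obs P xs hP hxs d)
    | cons u' e' =>
      rename_i d'
      have h' : Path.cons ((Path.nil.cons j).comp ((embObs P xs hP hxs).mapPath u)) ((embObs P xs hP hxs).map e) =
          Path.cons ((Path.nil.cons j').comp ((embObs P xs hP hxs).mapPath u')) ((embObs P xs hP hxs).map e') := h
      obtain ⟨hd, hu, he⟩ := Path.cons.inj h'
      obtain rfl : d = d' := (graphEmbedding_embObs P xs hP hxs hnot).obj_injective hd
      obtain ⟨rfl, hj, huu⟩ := outerTail_injective j u j' u' (eq_of_heq hu)
      cases huu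
      cases (graphEmbedding_embObs P xs hP hxs hnot).map_injective (eq_of_heq he)
      exact ⟨rfl, hj, HEq.rfl⟩

/-- An included path is not an outer path (the former avoids `An•[𝒳]`, the latter visits it).
[cite: MochizukiAbsTopIII2015, Definition 3.5 (iv) p.76] -/
theorem inner_ne_outer {a₀ b : (obsShape P xs).Vertex} (r₀ : Path a₀ b) {x : (anShape (Vmod := Vmod) (isArc := isArc)).Vertex}
    (hx : (embObs P xs hP hxs).obj a₀ = x) (a : Path x (anShape (Vmod := Vmod) (isArc := isArc)).obs) {c : DVertex Vmod isArc} {hc : P c}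
    (j : (anShape (Vmod := Vmod) (isArc := isArc)).obs ⟶ (anShape (Vmod := Vmod) (isArc := isArc)).base ⟨c, hP hc⟩)
    (u : Path ((obsShape P xs).base ⟨c, hc⟩) b) :
    ¬ HEq ((embObs P xs hP hxs).mapPath r₀) ((a.cons j).comp ((embObs P xs hP hxs).mapPath u)) := by
  subst hx
  intro h
  have h' := congrArg (anShape (Vmod := Vmod) (isArc := isArc)).lastSplit (eq_of_heq h)
  rw [lastSplit_embObs_mapPath, lastSplit_outerPath] at h'
  exact Option.some_ne_none _ h'.symm

variable (hcl : ∀ ⦃y : DVertex Vmod isArc⦄ ⦃c : DVertex Vmod isArc⦄, DEdge isArc y c → InFive (isArc := isArc) y → (P c ∨ c = xs) → P y)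
  (hxsJ : ∀ j : TelecoreIdx (Vmod := Vmod) (isArc := isArc) xs, False)

include hcl in
/-- An arrow of `D•_{≤5}` INTO the sub-diagram comes from the sub-diagram (predecessor-closure; relative sieve property on base
vertices). [cite: MochizukiAbsTopIII2015, Cor 5.5 p. 130] -/
theorem exists_edge_eq_embObs_map (y : DSub (InFive (Vmod := Vmod) (isArc := isArc))) (b : (obsShape P xs).Vertex)
    (e : (anShape (Vmod := Vmod) (isArc := isArc)).base y ⟶ (embObs P xs hP hxs).obj b) :
    ∃ (a : (obsShape P xs).Vertex) (e' : a ⟶ b), (embObs P xs hP hxs).obj a = (anShape (Vmod := Vmod) (isArc := isArc)).base y ∧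
      HEq ((embObs P xs hP hxs).map e') e := by
  cases b with
  | base b =>
    have hy : P y.1 := hcl (y := y.1) (c := b.1) e y.2 (Or.inl b.2)
    exact ⟨(obsShape P xs).base ⟨y.1, hy⟩, e, rfl, HEq.rfl⟩
  | obs =>
    have hy : P y.1 := hcl (y := y.1) (c := xs) e y.2 (Or.inr rfl)
    exact ⟨(obsShape P xs).base ⟨y.1, hy⟩, e, rfl, HEq.rfl⟩

/-- `HEq` of extended paths from `HEq` of their parts (bookkeeping for Def 3.5 (ii)). [cite: MochizukiAbsTopIII2015, Definition 3.5 (ii) p.75] -/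
theorem heq_cons {V : Type*} [Quiver V] {a a' b b' c c' : V} (ha : a = a') (hb : b = b') (hc : c = c') {p : Path a b}
    {p' : Path a' b'} {e : b ⟶ c} {e' : b' ⟶ c'} (hp : HEq p p') (he : HEq e e') : HEq (p.cons e) (p'.cons e') := by
  subst ha hb hc
  cases hp
  cases he
  rfl

include hcl hxsJ in
/-- **Inner or outer.**  Every path of `Γ⃗_{D_{An•}}` into a vertex of the sub-diagram `D_{≤P} ∪ {x}` is EITHER an included path (it
never visits `An•[𝒳]`) OR of the form `a ; φ_⋏ ; (included u)` — an arbitrary path `a` into the core vertex `An•[𝒳]`, a telecore edge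
`φ_⋏` into `𝒳_⋏ ∈ D_{≤P}`, and an included path `u` (the relative form of abc-iut-f-101's `IsSieve.exists_mapPath`: the telecore edges
are the only arrows entering the first rows from outside). [cite: MochizukiAbsTopIII2015, Cor 5.5 (ii) p. 130] -/
theorem exists_inner_or_outer {x : (anShape (Vmod := Vmod) (isArc := isArc)).Vertex} {y : (anShape (Vmod := Vmod) (isArc := isArc)).Vertex}
    (r : Path x y) : ∀ (b : (obsShape P xs).Vertex), y = (embObs P xs hP hxs).obj b →
      (∃ (a₀ : (obsShape P xs).Vertex) (r₀ : Path a₀ b), (embObs P xs hP hxs).obj a₀ = x ∧ HEq ((embObs P xs hP hxs).mapPath r₀) r) ∨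
        ∃ (a : Path x (anShape (Vmod := Vmod) (isArc := isArc)).obs) (c : DVertex Vmod isArc) (hc : P c)
          (j : (anShape (Vmod := Vmod) (isArc := isArc)).obs ⟶ (anShape (Vmod := Vmod) (isArc := isArc)).base ⟨c, hP hc⟩)
          (u : Path ((obsShape P xs).base ⟨c, hc⟩) b),
          HEq r ((a.cons j).comp ((embObs P xs hP hxs).mapPath u)) := by
  induction r with
  | nil =>
    rintro b rfl
    exact Or.inl ⟨b, Path.nil, rfl, HEq.rfl⟩
  | cons r e ih =>
    rename_i y₁ y
    rintro b rfl
    cases y₁ with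
    | obs =>
      -- the last arrow is a telecore edge `φ_⋏` out of `An•[𝒳]`
      cases b with
      | obs => exact (hxsJ e).elim
      | base c => exact Or.inr ⟨r, c.1, c.2, e, Path.nil, HEq.rfl⟩
    | base y₁ =>
      obtain ⟨a₁, e', ha₁, he⟩ := exists_edge_eq_embObs_map P xs hP hxs hcl y₁ b e
      rcases ih a₁ ha₁.symm with ⟨a₀, r₀, ha₀, hr⟩ | ⟨a, c, hc, j, u, hr⟩
      · refine Or.inl ⟨a₀, r₀.cons e', ha₀, ?_⟩
        rw [Prefunctor.mapPath_cons]
        exact heq_cons ha₀ ha₁ rfl hr he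
      · refine Or.inr ⟨a, c, hc, j, u.cons e', ?_⟩
        rw [Prefunctor.mapPath_cons]
        exact heq_cons rfl ha₁.symm rfl hr he.symm

include hcl hxsJ in
/-- Inner or outer, for a path into a vertex literally of the form `embObs b`. [cite: MochizukiAbsTopIII2015, Cor 5.5 (ii) p. 130] -/
theorem exists_inner_or_outer' {x : (anShape (Vmod := Vmod) (isArc := isArc)).Vertex} (b : (obsShape P xs).Vertex)
    (r : Path x ((embObs P xs hP hxs).obj b)) :
    (∃ (a₀ : (obsShape P xs).Vertex) (r₀ : Path a₀ b), (embObs P xs hP hxs).obj a₀ = x ∧ HEq ((embObs P xs hP hxs).mapPath r₀) r) ∨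
      ∃ (a : Path x (anShape (Vmod := Vmod) (isArc := isArc)).obs) (c : DVertex Vmod isArc) (hc : P c)
        (j : (anShape (Vmod := Vmod) (isArc := isArc)).obs ⟶ (anShape (Vmod := Vmod) (isArc := isArc)).base ⟨c, hP hc⟩)
        (u : Path ((obsShape P xs).base ⟨c, hc⟩) b),
        r = (a.cons j).comp ((embObs P xs hP hxs).mapPath u) := by
  rcases exists_inner_or_outer P xs hP hxs hcl hxsJ r b rfl with h | ⟨a, c, hc, j, u, h⟩
  · exact Or.inl h
  · exact Or.inr ⟨a, c, hc, j, u, eq_of_heq h⟩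

/-- No included path starts at the observation vertex `x` and ends at a base vertex of the sub-diagram (no arrow leaves an
observation vertex inside its observable, Def 3.5 (iii) (b)). [cite: MochizukiAbsTopIII2015, Definition 3.5 (iii) p.75] -/
theorem path_obs_base_elim (c : DSub P) (r₀ : Path (obsShape P xs).obs ((obsShape P xs).base c)) : False := by
  have h := eq_of_path_of_isEmpty_hom (ω := (obsShape P xs).obs)
    (ExtShape.isEmpty_hom_obs (obsShape P xs) (fun _ => (inferInstance : IsEmpty PEmpty.{u + 1}))) r₀
  cases h

end Paths

end LogFrobeniusSetting

end Literature.AnabelianGeometry.AbsoluteAnabelian
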